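import Summits.Ventures.YMGap.RobustBall.LoopActionMember
import Summits.Ventures.YMGap.RobustBall.RowsSDim3
import HarnessLib

/-!
# Venture YMGap, track ROBUST-BALL — `SU(2)` rows as WINDOWS in the Wilson coupling (`0 ≤ β_W ≤ β⋆_W`), tier 1 and tier 2,
# and their loop-action norm ball readings

HONEST FRAMING. WHAT THIS IS: a venture file (cell `pub-ymgap`, track Y2 ROBUST-BALL, seat rb-p1): the certificate inequalities of the
`SU(2)` row schemas (`su2_rowB`, `su2_rowBS`, `su2_rowS_dim`) are increasing in `β_W`, so every certified cell holds on the whole WINDOW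
`0 ≤ β_W ≤ β⋆_W` with the same radius — stated here once, by name, for the headline cells: tier 1 `ℤ⁴` (`su2_windowB_1_8`: radius `0.143`
for all `β_W ≤ 1/8`; `su2_windowB_1_10`: `0.209` for `β_W ≤ 1/10`), tier 2 `ℤ⁴` at weight `2^{dist}` (`su2_windowBS2_1_16`: `0.143` for
`β_W ≤ 1/16`; `su2_windowBS2_1_20`: `0.209` for `β_W ≤ 1/20`), tier 2 `ℤ³` (`su2_dim3_windowS2_1_16`: `0.219` for `β_W ≤ 1/16`), and the
loop-action norm ball forms `MassGapOnLoopBall 4 2 (β_W/4) (log 2) 0.143` for all `0 ≤ β_W ≤ 1/16` etc. (the all-`N` cells of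
`RowsSUNCells`/`RowsSDim3` are windows already). WHAT IT IS NOT: no new number; strong-coupling lattice statements, one-sided windows,
radii are door artefacts; nothing about the continuum limit or the Clay problem.

References: this track's `RowsSU2.lean` (`su2_rowB`), `RowsS.lean` (`su2_rowBS`), `RowsSDim3.lean` (`su2_rowS_dim`), `LoopActionMember.lean`.
-/

noncomputable section

open MeasureTheory Function Real
open Literature.Probability.LatticeModels
open Literature.MathematicalPhysics.QuantumLattice
open Literature.MathematicalPhysics.QuantumFieldTheory hiding ZdEdge Site

namespace Summit.Ventures.YMGap.RobustBall

variable {βW : ℝ}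

/-! ### Tier 1, `ℤ⁴` -/

/-- **Window (tier 1, lineage B): radius `0.143` for ALL `0 ≤ β_W ≤ 1/8`** (any range `R`). -/
theorem su2_windowB_1_8 (hβ0 : 0 ≤ βW) (hβ : βW ≤ 1 / 8) (R : ℝ) :
    MassGapOnBallZd 4 2 (βW / 4) (2 * (143 / 1000)) (143 / 1000) R := by
  refine su2_rowB R hβ0 (by linarith) (by norm_num) (by norm_num) ?_
  nlinarith

/-- **Window (tier 1, lineage B): radius `0.209` for ALL `0 ≤ β_W ≤ 1/10`.** -/
theorem su2_windowB_1_10 (hβ0 : 0 ≤ βW) (hβ : βW ≤ 1 / 10) (R : ℝ) :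
    MassGapOnBallZd 4 2 (βW / 4) (2 * (209 / 1000)) (209 / 1000) R := by
  refine su2_rowB R hβ0 (by linarith) (by norm_num) (by norm_num) ?_
  nlinarith

/-! ### Tier 2, `ℤ⁴`, weight `2^{dist}` -/

/-- **Window (tier 2, lineage B, `q = 2`): radius `0.143` for ALL `0 ≤ β_W ≤ 1/16`.** -/
theorem su2_windowBS2_1_16 (hβ0 : 0 ≤ βW) (hβ : βW ≤ 1 / 16) :
    MassGapOnBallZdS 4 2 (βW / 4) (2 * (143 / 1000)) (143 / 1000) (Real.log 2) := by
  refine su2_rowBS (q := 2) (by norm_num) hβ0 (by linarith) (by norm_num) (by norm_num) ?_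
  nlinarith

/-- **Window (tier 2, lineage B, `q = 2`): radius `0.209` for ALL `0 ≤ β_W ≤ 1/20`.** -/
theorem su2_windowBS2_1_20 (hβ0 : 0 ≤ βW) (hβ : βW ≤ 1 / 20) :
    MassGapOnBallZdS 4 2 (βW / 4) (2 * (209 / 1000)) (209 / 1000) (Real.log 2) := by
  refine su2_rowBS (q := 2) (by norm_num) hβ0 (by linarith) (by norm_num) (by norm_num) ?_
  nlinarith

/-! ### Tier 2, `ℤ³`, weight `2^{dist}` -/

/-- **Window (tier 2, `ℤ³`, `q = 2`): radius `0.219` for ALL `0 ≤ β_W ≤ 1/16`.** -/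
theorem su2_dim3_windowS2_1_16 (hβ0 : 0 ≤ βW) (hβ : βW ≤ 1 / 16) :
    MassGapOnBallZdS 3 2 (βW / 4) (2 * (219 / 1000)) (219 / 1000) (Real.log 2) := by
  refine su2_rowS_dim (d := 3) (by norm_num) (q := 2) (by norm_num) hβ0 (by norm_num) (by norm_num) ?_
  push_cast
  nlinarith

/-! ### The loop-action norm ball on the windows -/

/-- **`SU(2)`, `d = 4`: `MassGapOnLoopBall 4 2 (β_W/4) (log 2) 0.143` for ALL `0 ≤ β_W ≤ 1/16`** — every generic Wilson-type loop
action with `‖c‖_{log 2} ≤ 0.143`, uniformly on the coupling window. -/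
theorem su2_massGapOnLoopBall_window_1_16 (hβ0 : 0 ≤ βW) (hβ : βW ≤ 1 / 16) :
    MassGapOnLoopBall 4 2 (βW / 4) (Real.log 2) (143 / 1000) :=
  (su2_windowBS2_1_16 hβ0 hβ).massGapOnLoopBall

/-- **`SU(2)`, `d = 4`: `MassGapOnLoopBall 4 2 (β_W/4) (log 2) 0.209` for ALL `0 ≤ β_W ≤ 1/20`.** -/
theorem su2_massGapOnLoopBall_window_1_20 (hβ0 : 0 ≤ βW) (hβ : βW ≤ 1 / 20) :
    MassGapOnLoopBall 4 2 (βW / 4) (Real.log 2) (209 / 1000) :=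
  (su2_windowBS2_1_20 hβ0 hβ).massGapOnLoopBall

/-- **`SU(2)`, `d = 3`: `MassGapOnLoopBall 3 2 (β_W/4) (log 2) 0.219` for ALL `0 ≤ β_W ≤ 1/16`.** -/
theorem su2_dim3_massGapOnLoopBall_window_1_16 (hβ0 : 0 ≤ βW) (hβ : βW ≤ 1 / 16) :
    MassGapOnLoopBall 3 2 (βW / 4) (Real.log 2) (219 / 1000) :=
  (su2_dim3_windowS2_1_16 hβ0 hβ).massGapOnLoopBall

end Summit.Ventures.YMGap.RobustBall

end
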